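import Summits.Ventures.PercRepro.Injective

/-!
# C-026: the Harris-matching upper bound `P(a~b)·P(c iso) ≤ P(exactly one pair)` (p5, gen 7)

C-026 (mine-3's `M3-Q3`, CONJECTURES v105 2026-08-22T13:29:30Z): for every finite multigraph,
every `p ∈ [0,1]^E` and every three marks `a, b, c`,
`P(a ~ b) · P(c ≁ a ∧ c ≁ b) ≤ P(ab|c) + P(ac|b) + P(bc|a)`.
Harris (an increasing times a decreasing event) gives the LOWER bound
`P(ab|c) = P(a ~ b ∧ c iso) ≤ P(a ~ b) · P(c iso)`; C-026 is the matching UPPER bound: the Harris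
defect `P(a ~ b) · P(c iso) − P(ab|c)` is at most `P(ac|b) + P(bc|a)`.  On the `law3` rows
`x, y₁, y₂, y₃, z` it reads `(x + y₁)(y₁ + z) ≤ y₁ + y₂ + y₃`.

Typed exactly as typer-2's C-017 (`ClassPositive.lean`, `Injective.lean`):

* **`C026`** — the statement on the `law3` rows; **`kernel26`** — its kernel
  `[σ one pair] − [σ joins ab]·[τ isolates c]`; **`quadForm_kernel26`** — the quadratic form of the
  kernel IS the row slack; `C026_iff_quadForm`;
* **`C026UpTo N`** (every multigraph with ≤ N vertices), **`C026UpTo_of_classPositive`**,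
  **`C026UpTo_of_simple`** — the antipodal principle: class positivity of `kernel26` on the simple
  graphs with ≤ N vertices gives C-026 at every `p` on every multigraph with ≤ N vertices;
* repeated marks: `a = b` gives a nonnegative class sum (`cubeSumQuad_kernel26_nonneg_of_eq01`,
  by the pairing `ρ ↦ ρᶜ`), `a = c` or `b = c` a pointwise nonnegative kernel (`kernel26_nonneg_of_eq02`, `kernel26_nonneg_of_eq12`), hence
  **`cubeSumQuad_kernel26_nonneg_of_not_injective`** and **`C026UpTo_of_simpleInj`** — the census over
  injective 3-markings suffices.

The class-level pairing (`Bad₃`, the cut tree `δ`) and the pass scheme are in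
`Summits.Ventures.PercRepro.C026Pairing` / `C026Pass`.
-/

namespace PercRepro

open Finset

/-- **C-026** (mine-3's M3-Q3, CONJECTURES v105 2026-08-22T13:29:30Z — the Harris-matching upper
bound): for every finite multigraph, `p ∈ [0,1]^E` and marks `a, b, c`,
`P(a~b)·P(c ≁ a ∧ c ≁ b) ≤ P(ab|c) + P(ac|b) + P(bc|a)` — on the `law3` rows
`(x + y₁)(y₁ + z) ≤ y₁ + y₂ + y₃`. -/
def C026 : Prop :=
  ∀ {V E : Type} [Fintype E] [DecidableEq E] (G : MultiGraph V E) (p : E → ℝ), IsProb p →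
    ∀ a b c : V,
      (G.law3 p a b c 0 + G.law3 p a b c 1) * (G.law3 p a b c 1 + G.law3 p a b c 4) ≤
        G.law3 p a b c 1 + G.law3 p a b c 2 + G.law3 p a b c 3

/-- **The kernel of C-026**: `[σ one pair] − [σ joins ab]·[τ isolates c]` through the rows
(`one pair` = rows `1, 2, 3`; `a ~ b` = rows `0, 1`; `c ≁ a ∧ c ≁ b` = rows `1, 4`). -/
noncomputable def kernel26 (σ τ : Setoid (Fin 3)) : ℝ :=
  (rowInd3 1 σ + rowInd3 2 σ + rowInd3 3 σ) -
    (rowInd3 0 σ + rowInd3 1 σ) * (rowInd3 1 τ + rowInd3 4 τ)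

namespace MultiGraph

variable {V E : Type*} (G : MultiGraph V E) [Fintype E] [DecidableEq E]

/-- **The quadratic form of `kernel26` is the C-026 slack**
`(y₁ + y₂ + y₃) − (x + y₁)(y₁ + z)`. -/
theorem quadForm_kernel26 (p : E → ℝ) (a b c : V) :
    G.quadForm p ![a, b, c] kernel26 =
      (G.law3 p a b c 1 + G.law3 p a b c 2 + G.law3 p a b c 3) -
        (G.law3 p a b c 0 + G.law3 p a b c 1) * (G.law3 p a b c 1 + G.law3 p a b c 4) := by
  unfold quadForm kernel26
  simp only [mul_sub, Finset.sum_sub_distrib]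
  rw [sum_sum_weight_mul_left, sum_sum_weight_mul_mul]
  simp only [law3_eq_sum_rowInd3, mul_add, Finset.sum_add_distrib]

end MultiGraph

/-- C-026 is the nonnegativity of the quadratic form of `kernel26`. -/
theorem C026_iff_quadForm : C026 ↔
    ∀ {V E : Type} [Fintype E] [DecidableEq E] (G : MultiGraph V E) (p : E → ℝ), IsProb p →
      ∀ a b c : V, 0 ≤ G.quadForm p ![a, b, c] kernel26 := by
  constructor
  · intro h V E _ _ G p hp a b c
    rw [G.quadForm_kernel26]
    have := h G p hp a b c
    linarith
  · intro h V E _ _ G p hp a b c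
    have := h G p hp a b c
    rw [G.quadForm_kernel26] at this
    linarith

/-- **C-026 on every multigraph with at most `N` vertices**, every `p`, every three marks. -/
def C026UpTo (N : ℕ) : Prop :=
  ∀ {V E : Type} [Fintype V] [Fintype E] [DecidableEq E], Fintype.card V ≤ N →
    ∀ (G : MultiGraph V E) (p : E → ℝ), IsProb p → ∀ a b c : V,
      (G.law3 p a b c 0 + G.law3 p a b c 1) * (G.law3 p a b c 1 + G.law3 p a b c 4) ≤
        G.law3 p a b c 1 + G.law3 p a b c 2 + G.law3 p a b c 3

/-- **C-026 on ≤ N vertices from the class positivity of its kernel on ≤ N vertices.** -/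
theorem C026UpTo_of_classPositive {N : ℕ} (h : ClassPositiveUpTo 3 N kernel26) : C026UpTo N := by
  intro V E _ _ _ hV G p hp a b c
  have := QuadNonnegUpTo_of_classPositive h hV G p hp ![a, b, c]
  rw [G.quadForm_kernel26] at this
  linarith

/-- **C-026 on ≤ N vertices from the simple-graph class census.** -/
theorem C026UpTo_of_simple {N : ℕ} (h : ClassPositiveSimpleUpTo 3 N kernel26) : C026UpTo N :=
  C026UpTo_of_classPositive (ClassPositiveUpTo_of_simple h)

/-! ### Repeated marks -/

/-- The rows `abc` and `ab|c` are different partitions (`a ~ c` in the first, not in the second):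
at most one of their indicators is `1`. -/
theorem rowInd3_zero_add_rowInd3_one_le_one (σ : Setoid (Fin 3)) :
    rowInd3 0 σ + rowInd3 1 σ ≤ 1 := by
  unfold rowInd3
  split_ifs with h0 h1
  · exfalso
    have hrel : (Setoid.ker (rgs3 0)) 0 2 := by
      rw [Setoid.ker_def]
      decide
    rw [h0.symm.trans h1, Setoid.ker_def] at hrel
    exact absurd hrel (by decide)
  all_goals norm_num

namespace MultiGraph

variable {V E : Type*} (G : MultiGraph V E) [Fintype E] [DecidableEq E]

omit [Fintype E] [DecidableEq E] in
/-- `a = c`: the C-026 kernel is pointwise nonnegative (`c` is never isolated from `a`). -/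
theorem kernel26_nonneg_of_eq02 (ω ω' : Config E) (m : Fin 3 → V) (h : m 0 = m 2) :
    0 ≤ kernel26 (G.markedPartition ω m) (G.markedPartition ω' m) := by
  unfold kernel26
  have h1 := rowInd3_eq_zero_of_joined (s := 1) (by decide) (G.markedPartition_rel_of_eq ω' m h)
  have h4 := rowInd3_eq_zero_of_joined (s := 4) (by decide) (G.markedPartition_rel_of_eq ω' m h)
  rw [h1, h4]
  have := rowInd3_nonneg 1 (G.markedPartition ω m)
  have := rowInd3_nonneg 2 (G.markedPartition ω m)
  have := rowInd3_nonneg 3 (G.markedPartition ω m)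
  linarith

omit [Fintype E] [DecidableEq E] in
/-- `b = c`: the C-026 kernel is pointwise nonnegative (`c` is never isolated from `b`). -/
theorem kernel26_nonneg_of_eq12 (ω ω' : Config E) (m : Fin 3 → V) (h : m 1 = m 2) :
    0 ≤ kernel26 (G.markedPartition ω m) (G.markedPartition ω' m) := by
  unfold kernel26
  have h1 := rowInd3_eq_zero_of_joined (s := 1) (by decide) (G.markedPartition_rel_of_eq ω' m h)
  have h4 := rowInd3_eq_zero_of_joined (s := 4) (by decide) (G.markedPartition_rel_of_eq ω' m h)
  rw [h1, h4]
  have := rowInd3_nonneg 1 (G.markedPartition ω m)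
  have := rowInd3_nonneg 2 (G.markedPartition ω m)
  have := rowInd3_nonneg 3 (G.markedPartition ω m)
  linarith

omit [Fintype E] [DecidableEq E] in
/-- `a = b`: the rows `ac|b`, `bc|a`, `a|b|c` never occur, and the kernel is at least
`[σ = ab|c] − [τ = ab|c]`. -/
theorem kernel26_ge_of_eq01 (ω ω' : Config E) (m : Fin 3 → V) (h : m 0 = m 1) :
    rowInd3 1 (G.markedPartition ω m) - rowInd3 1 (G.markedPartition ω' m) ≤
      kernel26 (G.markedPartition ω m) (G.markedPartition ω' m) := by
  unfold kernel26
  have h2 := rowInd3_eq_zero_of_joined (s := 2) (by decide) (G.markedPartition_rel_of_eq ω m h)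
  have h3 := rowInd3_eq_zero_of_joined (s := 3) (by decide) (G.markedPartition_rel_of_eq ω m h)
  have h4' := rowInd3_eq_zero_of_joined (s := 4) (by decide) (G.markedPartition_rel_of_eq ω' m h)
  rw [h2, h3, h4']
  have hle := rowInd3_zero_add_rowInd3_one_le_one (G.markedPartition ω m)
  have hnn := rowInd3_nonneg 1 (G.markedPartition ω' m)
  have hnn0 := rowInd3_nonneg 0 (G.markedPartition ω m)
  have hnn1 := rowInd3_nonneg 1 (G.markedPartition ω m)
  nlinarith

/-- `a = b`: the C-026 class sum is nonnegative (`ρ ↦ ρᶜ` pairs the row `ab|c` with itself). -/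
theorem cubeSumQuad_kernel26_nonneg_of_eq01 (m : Fin 3 → V) (h : m 0 = m 1) :
    0 ≤ G.cubeSumQuad m kernel26 := by
  unfold cubeSumQuad cubeSum
  have hzero : ∑ ρ : Config E,
      (rowInd3 1 (G.markedPartition ρ m) - rowInd3 1 (G.markedPartition ρᶜ m)) = 0 := by
    rw [Finset.sum_sub_distrib, sub_eq_zero]
    exact (Fintype.sum_bijective (fun ρ : Config E => ρᶜ) compl_involutive.bijective _ _
      fun ρ => rfl).symm
  rw [← hzero]
  exact Finset.sum_le_sum fun ρ _ => G.kernel26_ge_of_eq01 ρ ρᶜ m h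

/-- **The C-026 class sum is nonnegative for every non-injective marking.** -/
theorem cubeSumQuad_kernel26_nonneg_of_not_injective (m : Fin 3 → V)
    (h : ¬ Function.Injective m) : 0 ≤ G.cubeSumQuad m kernel26 := by
  obtain ⟨i, j, hij, hne⟩ : ∃ i j, m i = m j ∧ i ≠ j := by
    unfold Function.Injective at h
    push Not at h
    obtain ⟨i, j, h1, h2⟩ := h
    exact ⟨i, j, h1, h2⟩
  have key : ∀ i j : Fin 3, i ≠ j → m i = m j → 0 ≤ G.cubeSumQuad m kernel26 := by
    intro i j hne hij
    fin_cases i <;> fin_cases j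
    all_goals first
      | exact absurd rfl hne
      | exact G.cubeSumQuad_kernel26_nonneg_of_eq01 m hij
      | exact G.cubeSumQuad_kernel26_nonneg_of_eq01 m hij.symm
      | exact Finset.sum_nonneg fun ρ _ => G.kernel26_nonneg_of_eq02 ρ ρᶜ m hij
      | exact Finset.sum_nonneg fun ρ _ => G.kernel26_nonneg_of_eq02 ρ ρᶜ m hij.symm
      | exact Finset.sum_nonneg fun ρ _ => G.kernel26_nonneg_of_eq12 ρ ρᶜ m hij
      | exact Finset.sum_nonneg fun ρ _ => G.kernel26_nonneg_of_eq12 ρ ρᶜ m hij.symm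
  exact key i j hne hij

end MultiGraph

/-- For `kernel26` the injective census gives the full hypothesis. -/
theorem ClassPositiveSimpleUpTo_kernel26_of_inj {N : ℕ}
    (h : ClassPositiveSimpleInjUpTo 3 N kernel26) : ClassPositiveSimpleUpTo 3 N kernel26 := by
  intro V E _ _ _ hV G hs m
  by_cases hm : Function.Injective m
  · exact h hV G hs m hm
  · exact G.cubeSumQuad_kernel26_nonneg_of_not_injective m hm

/-- **C-026 on ≤ N vertices from the injective simple-graph class census** — mine-3's 3-subset
census: `ClassPositiveSimpleInjUpTo 3 7 kernel26` is the `n ≤ 7` class-positivity row. -/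
theorem C026UpTo_of_simpleInj {N : ℕ} (h : ClassPositiveSimpleInjUpTo 3 N kernel26) :
    C026UpTo N :=
  C026UpTo_of_simple (ClassPositiveSimpleUpTo_kernel26_of_inj h)

end PercRepro
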